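import Literature.NumberTheory.CubicFields.VoronoiReduction
import Literature.NumberTheory.CubicFields.PureCubicLatticeSemantics
import HarnessLib

/-!
# Size of the canonical codes of reduced ideals of a pure cubic field

Topic `Literature/NumberTheory/CubicFields`; uses `VoronoiReduction.lean` (norm bound of a relative
minimum) and `PureCubicLatticeSemantics.lean` (canonical lattice codes `Canon`, member sets `Mem`,
`dvd_of_mem_imp`). The labels walked by the cubic infrastructure are the canonical codes
`c = (den, [h11, h12, h13, h22, h23, h33])` of the REDUCED principal ideals `ν⁻¹ 𝓞_K`, `ν` a
relative minimum of `𝓞_K`; their size is polynomial in the discriminant: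

* `canon_cube` — the code `(N, [1, 0, 0, 1, 0, 1])` of `(1/N) ℤ⟨1, θ, θ₂⟩` is canonical;
  `den_dvd_of_mul_mem_order` — if `N ·` (member set of `c`) `⊆ ℤ⟨1, θ, θ₂⟩` then `den ∣ N`;
* `den_dvd_three_mul_natAbs_norm` — for the code of `ν⁻¹ 𝓞_K`, `ν ∈ 𝓞_K ∖ 0`:
  `den ∣ 3 |N(ν)|` (`|N(ν)| ν⁻¹ ∈ 𝓞_K` and Dedekind's `3 𝓞_K ⊆ ℤ⟨1, θ, θ₂⟩`);
* `three_mul_natAbs_norm_le` — `3 |N(ν)| ≤ 6 √|d_K| / π` for a relative minimum `ν` of `𝓞_K`;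
* `entries_le_den` — if `1, θ, θ₂` are members then every entry lies in `[0, den]`
  (the diagonal divides `den`).

Theorem-only file.

## References

* H. Cohen, *A Course in Computational Algebraic Number Theory*, GTM 138, Springer 1993, §4.7.1,
  §6.4.5. [Cohen1993]
* J. Buchmann, H. C. Williams, *On the infrastructure of the principal ideal class of an algebraic
  number field of unit rank one*, Math. Comp. 50 (1988), §3. [BuchmannWilliams1988Infrastructure]
-/

namespace Literature.NumberTheory.CubicFields

open scoped NumberField nonZeroDivisors
open NumberField PureCubicCodes

section LabelBounds

variable {K : Type*} [Field K]

/-- **The code of `(1/N) ℤ⟨1, θ, θ₂⟩` is canonical** (`N ≥ 1`). [cite: Cohen1993, §4.7.1] -/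
theorem PureCubicCodes.canon_cube {N : ℕ} (hN : 1 ≤ N) : Canon (N, [1, 0, 0, 1, 0, 1]) :=
  ⟨1, 0, 0, 1, 0, 1, rfl, one_pos, one_pos, one_pos, le_rfl, one_pos, le_rfl, one_pos, le_rfl, one_pos, hN,
    by simp⟩

/-- **A common denominator is a multiple of the canonical one**: if `N · φ ∈ ℤ⟨1, θ, θ₂⟩` for every
member `φ` of the canonical code `c`, then `c.1 ∣ N`. [cite: Cohen1993, §4.7.1] -/
theorem PureCubicCodes.den_dvd_of_mul_mem_order [CharZero K] (θ : K) (b : ℕ)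
    (hind : ∀ c₀ c₁ c₂ : ℚ, (c₀ : K) + (c₁ : K) * θ + (c₂ : K) * (θ ^ 2 / (b : K)) = 0 → c₀ = 0 ∧ c₁ = 0 ∧ c₂ = 0)
    {c : ℕ × List ℤ} (hc : Canon c) {N : ℕ} (hN : 1 ≤ N)
    (h : ∀ φ : K, Mem θ b c φ → ∃ u v w : ℤ, (N : K) * φ = u + v * θ + w * (θ ^ 2 / (b : K))) : c.1 ∣ N :=
  dvd_of_mem_imp θ b hind hc (canon_cube hN) fun φ hφ => by
    obtain ⟨u, v, w, e⟩ := h φ hφ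
    exact ⟨1, 0, 0, 1, 0, 1, u, v, w, rfl, by push_cast; simpa using e⟩

variable [NumberField K]

/-- **The denominator of the code of a reduced principal ideal divides `3 |N(ν)|`.** If the member
set of the canonical code `c` lies in `ν⁻¹ 𝓞_K` (`ν = x ∈ 𝓞_K ∖ 0`) and `3 𝓞_K ⊆ ℤ⟨1, θ, θ₂⟩`
(Dedekind), then `c.1 ∣ 3 |N(x)|`: indeed `|N(x)| ∈ x 𝓞_K`, so `3 |N(x)| ν⁻¹ 𝓞_K ⊆ 3 𝓞_K ⊆ ℤ⟨1, θ, θ₂⟩`.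
[cite: Cohen1993, §4.7.1] -/
theorem PureCubicCodes.den_dvd_three_mul_natAbs_norm (θ : K) (b : ℕ)
    (hind : ∀ c₀ c₁ c₂ : ℚ, (c₀ : K) + (c₁ : K) * θ + (c₂ : K) * (θ ^ 2 / (b : K)) = 0 → c₀ = 0 ∧ c₁ = 0 ∧ c₂ = 0)
    (h3 : ∀ ξ : 𝓞 K, ∃ c₀ c₁ c₂ : ℤ, (3 : K) * (ξ : K) = c₀ + c₁ * θ + c₂ * (θ ^ 2 / (b : K)))
    {c : ℕ × List ℤ} (hc : Canon c) {x : 𝓞 K} (hx : x ≠ 0)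
    (hcJ : ∀ φ : K, Mem θ b c φ → φ ∈ FractionalIdeal.spanSingleton (𝓞 K)⁰ (algebraMap (𝓞 K) K x)⁻¹ * (1 : FractionalIdeal (𝓞 K)⁰ K)) :
    c.1 ∣ 3 * (Algebra.norm ℤ x).natAbs := by
  set M : ℕ := (Algebra.norm ℤ x).natAbs with hM
  have hM0 : M ≠ 0 := by
    rw [hM, Ne, Int.natAbs_eq_zero]; exact Algebra.norm_ne_zero_iff.mpr hx
  have hx0 : algebraMap (𝓞 K) K x ≠ 0 := RingOfIntegers.coe_ne_zero_iff.mpr hx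
  -- `M = y x` in `𝓞 K`
  obtain ⟨y, hy⟩ : ∃ y : 𝓞 K, y * x = (M : 𝓞 K) := by
    rw [← Ideal.mem_span_singleton', hM, ← Ideal.absNorm_span_singleton x]
    exact Ideal.absNorm_mem _
  have hyK : (M : K) * (algebraMap (𝓞 K) K x)⁻¹ = algebraMap (𝓞 K) K y := by
    rw [eq_comm, eq_mul_inv_iff_mul_eq₀ hx0, ← map_mul, hy, map_natCast]
  refine den_dvd_of_mul_mem_order θ b hind hc (by omega) fun φ hφ => ?_
  obtain ⟨ξ', hξ', rfl⟩ := FractionalIdeal.mem_singleton_mul.mp (hcJ φ hφ)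
  obtain ⟨ξ, rfl⟩ := (FractionalIdeal.mem_one_iff _).mp hξ'
  obtain ⟨c₀, c₁, c₂, e⟩ := h3 (y * ξ)
  refine ⟨c₀, c₁, c₂, ?_⟩
  have e' : (3 : K) * (algebraMap (𝓞 K) K y * algebraMap (𝓞 K) K ξ) = c₀ + c₁ * θ + c₂ * (θ ^ 2 / (b : K)) := by
    rw [← e, ← map_mul]
  rw [← e', ← hyK]
  push_cast
  ring

/-- **The norm of a relative minimum of `𝓞_K` is small**: `3 |N(x)| ≤ 6 √|d_K| / π`
(`|N(x)| = |σ₁ x| ‖σ₂ x‖² ≤ (2√|d_K|/π) N(𝓞_K)`). [cite: BuchmannWilliams1988Infrastructure, §3] -/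
theorem three_mul_natAbs_norm_le {σ₁ : K →+* ℝ} {σ₂ : K →+* ℂ} (hdeg : Module.finrank ℚ K = 3)
    (hσ₂ : ∃ z : K, starRingEnd ℂ (σ₂ z) ≠ σ₂ z) {x : 𝓞 K}
    (hν : algebraMap (𝓞 K) K x ∈ relMinima σ₁ σ₂ (1 : FractionalIdeal (𝓞 K)⁰ K)) :
    ((3 * (Algebra.norm ℤ x).natAbs : ℕ) : ℝ) ≤ 6 * Real.sqrt |(discr K : ℝ)| / Real.pi := by
  have h := abs_mul_norm_sq_le_of_mem_relMinima hdeg hσ₂ hν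
  rw [FractionalIdeal.absNorm_one, Rat.cast_one, mul_one] at h
  have hN := norm_eq_mul_norm_sq σ₁ σ₂ hdeg hσ₂ (algebraMap (𝓞 K) K x)
  have habs : (((Algebra.norm ℤ x).natAbs : ℕ) : ℝ) = |σ₁ (algebraMap (𝓞 K) K x)| * ‖σ₂ (algebraMap (𝓞 K) K x)‖ ^ 2 := by
    rw [Nat.cast_natAbs, Int.cast_abs, ← abs_of_nonneg (sq_nonneg ‖σ₂ (algebraMap (𝓞 K) K x)‖), ← abs_mul, ← hN]
    congr 1
    have := Algebra.coe_norm_int x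
    rw [RingOfIntegers.coe_eq_algebraMap] at this
    exact_mod_cast congrArg (fun q : ℚ => (q : ℝ)) this
  push_cast
  rw [habs]
  have e : (6 : ℝ) * Real.sqrt |(discr K : ℝ)| / Real.pi = 3 * (2 * Real.sqrt |(discr K : ℝ)| / Real.pi) := by ring
  rw [e]
  linarith

omit [NumberField K] in
/-- **Entries of the code of an over-order are at most the denominator.** If `1`, `θ` and `θ₂` are
members of the canonical code `c` (e.g. `𝓞_K ⊆` the lattice), then every entry of `c` lies in
`[0, c.1]` (the diagonal entries divide `c.1`, the others are reduced). [cite: Cohen1993, §4.7.1] -/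
theorem PureCubicCodes.entries_le_den [CharZero K] (θ : K) (b : ℕ)
    (hind : ∀ c₀ c₁ c₂ : ℚ, (c₀ : K) + (c₁ : K) * θ + (c₂ : K) * (θ ^ 2 / (b : K)) = 0 → c₀ = 0 ∧ c₁ = 0 ∧ c₂ = 0)
    {c : ℕ × List ℤ} (hc : Canon c) (h1 : Mem θ b c 1) (hθ : Mem θ b c θ) (hθ₂ : Mem θ b c (θ ^ 2 / (b : K))) :
    ∀ h ∈ c.2, 0 ≤ h ∧ h ≤ c.1 := by
  obtain ⟨h11, h12, h13, h22, h23, h33, hc2, p11, p22, p33, n12, l12, n13, l13, n23, l23, hD, -⟩ := hc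
  -- read the three memberships through the independence of `(1, θ, θ₂)`
  have key : ∀ (u v w : ℤ) (x y z : ℤ),
      ((x : ℤ) : K) + ((y : ℤ) : K) * θ + ((z : ℤ) : K) * (θ ^ 2 / (b : K)) =
        ((u * h11 : ℤ) : K) + ((u * h12 + v * h22 : ℤ) : K) * θ + ((u * h13 + v * h23 + w * h33 : ℤ) : K) * (θ ^ 2 / (b : K)) →
      x = u * h11 ∧ y = u * h12 + v * h22 ∧ z = u * h13 + v * h23 + w * h33 := by
    intro u v w x y z e
    obtain ⟨e1, e2, e3⟩ := hind ((x : ℚ) - (u * h11 : ℤ)) ((y : ℚ) - (u * h12 + v * h22 : ℤ))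
      ((z : ℚ) - (u * h13 + v * h23 + w * h33 : ℤ)) (by push_cast at e ⊢; linear_combination e)
    refine ⟨?_, ?_, ?_⟩
    · exact_mod_cast sub_eq_zero.mp e1
    · exact_mod_cast sub_eq_zero.mp e2
    · exact_mod_cast sub_eq_zero.mp e3
  have read : ∀ {φ : K}, Mem θ b c φ → ∃ u v w : ℤ, ((c.1 : ℕ) : K) * φ =
      ((u * h11 : ℤ) : K) + ((u * h12 + v * h22 : ℤ) : K) * θ + ((u * h13 + v * h23 + w * h33 : ℤ) : K) * (θ ^ 2 / (b : K)) := by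
    rintro φ ⟨g11, g12, g13, g22, g23, g33, u, v, w, hc2', e⟩
    rw [hc2] at hc2'
    simp only [List.cons.injEq, and_true] at hc2'
    obtain ⟨rfl, rfl, rfl, rfl, rfl, rfl⟩ := hc2'
    exact ⟨u, v, w, e⟩
  -- `1`: `den = u h11`
  obtain ⟨u₁, v₁, w₁, e₁⟩ := read h1
  obtain ⟨a1, -, -⟩ := key u₁ v₁ w₁ c.1 0 0 (by push_cast at e₁ ⊢; linear_combination e₁)
  -- `θ`: `u = 0`, `den = v h22`
  obtain ⟨u₂, v₂, w₂, e₂⟩ := read hθ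
  obtain ⟨a2, b2, -⟩ := key u₂ v₂ w₂ 0 c.1 0 (by push_cast at e₂ ⊢; linear_combination e₂)
  have hu₂ : u₂ = 0 := by rcases mul_eq_zero.mp a2.symm with h | h <;> [exact h; omega]
  rw [hu₂, zero_mul, zero_add] at b2
  -- `θ₂`: `u = v = 0`, `den = w h33`
  obtain ⟨u₃, v₃, w₃, e₃⟩ := read hθ₂
  obtain ⟨a3, b3, c3⟩ := key u₃ v₃ w₃ 0 0 c.1 (by push_cast at e₃ ⊢; linear_combination e₃)
  have hu₃ : u₃ = 0 := by rcases mul_eq_zero.mp a3.symm with h | h <;> [exact h; omega]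
  rw [hu₃, zero_mul, zero_add] at b3
  have hv₃ : v₃ = 0 := by rcases mul_eq_zero.mp b3.symm with h | h <;> [exact h; omega]
  rw [hu₃, hv₃, zero_mul, zero_mul, zero_add, zero_add] at c3
  have hD0 : (0 : ℤ) < c.1 := by exact_mod_cast hD
  have d11 : h11 ≤ c.1 := Int.le_of_dvd hD0 ⟨u₁, by rw [a1, mul_comm]⟩
  have d22 : h22 ≤ c.1 := Int.le_of_dvd hD0 ⟨v₂, by rw [b2, mul_comm]⟩
  have d33 : h33 ≤ c.1 := Int.le_of_dvd hD0 ⟨w₃, by rw [c3, mul_comm]⟩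
  intro h hh
  rw [hc2] at hh
  simp only [List.mem_cons, List.not_mem_nil, or_false] at hh
  rcases hh with rfl | rfl | rfl | rfl | rfl | rfl <;> constructor <;> omega

end LabelBounds

end Literature.NumberTheory.CubicFields
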